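import Summits.CriticalPhenomena.PercolationContinuityZ3.Theorems.PercNearOneGluingNoHeavyLowerTailIncStarWDOMTwoProngedCore
import Summits.CriticalPhenomena.PercolationContinuityZ3.Theorems.PercNearOneGluingAdditiveGluingSigmaLaw
import HarnessLib

/-!
# The all-or-nothing root lemma, part 2: graph and coupling lemmas (Sahi programme, prover prim-sahi-p2 gen 36)

Support file (`--supports stmt-CriticalPhenomena-4575`); no definitions, no named facts, no sorries; standard axioms.  Memo
`run/shared/lean/prim/prim-sahi/FROM-prim-sahi-p2-gen36-ALL-OR-NOTHING.md` §2.  Tools for `allOrNothing_root` (part 3):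
the "last exit from the root" decomposition of `{s ↔ y}` (`reach_root_iff`), the configuration away from the root pairs
(`sdiff_rootPairs_insert`, `sdiff_rootPairs_union`), the push-forward of a product law under `ω ↦ ω ∪ F` (`real_map_union`), and the two
insert-couplings `P¹⁰ = P⁰⁰ ∘ (insert e₁)⁻¹`, `P⁰¹ = P⁰⁰ ∘ (insert e₂)⁻¹` complementing those of `…WDOMTwoProngedCore`.
-/

noncomputable section

namespace Summit.CriticalPhenomena.PercolationContinuityZ3.Theorems

namespace IncStar

open MeasureTheory Set Literature.Probability.Percolation Literature.Probability.LatticeModels EdgeInduction ProbabilityTheory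
open scoped Classical

variable {n : ℕ}

/-! ### The configuration away from the root pairs -/

/-- Inserting a pair containing the root does not change the configuration away from the root. [folklore] -/
theorem sdiff_rootPairs_insert {s : Fin n} {e : Sym2 (Fin n)} (he : s ∈ e) (ω : BondConfig (Fin n)) :
    insert e ω \ {f : Sym2 (Fin n) | s ∈ f} = ω \ {f : Sym2 (Fin n) | s ∈ f} := by
  ext f
  simp only [Set.mem_sdiff, Set.mem_insert_iff, Set.mem_setOf_eq]
  constructor
  · rintro ⟨hf | hf, hnot⟩
    · exact absurd (hf ▸ he) hnot
    · exact ⟨hf, hnot⟩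
  · rintro ⟨hf, hnot⟩
    exact ⟨Or.inr hf, hnot⟩

/-- Opening a set of pairs at the root does not change the configuration away from the root. [folklore] -/
theorem sdiff_rootPairs_union {s : Fin n} {F : Set (Sym2 (Fin n))} (hF : ∀ e ∈ F, s ∈ e) (ω : BondConfig (Fin n)) :
    (ω ∪ F) \ {f : Sym2 (Fin n) | s ∈ f} = ω \ {f : Sym2 (Fin n) | s ∈ f} := by
  ext f
  simp only [Set.mem_sdiff, Set.mem_union, Set.mem_setOf_eq]
  constructor
  · rintro ⟨hf | hf, hnot⟩
    · exact ⟨hf, hnot⟩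
    · exact absurd (hF f hf) hnot
  · rintro ⟨hf, hnot⟩
    exact ⟨Or.inl hf, hnot⟩

/-- Reachability away from the root is monotone in the configuration. [folklore] -/
theorem reach_offRoot_mono {s u y : Fin n} {ω ω' : BondConfig (Fin n)} (hle : ω ≤ ω')
    (h : (openGraph (ω \ {f : Sym2 (Fin n) | s ∈ f})).Reachable u y) :
    (openGraph (ω' \ {f : Sym2 (Fin n) | s ∈ f})).Reachable u y :=
  h.mono (openGraph_mono (fun _ hf => ⟨hle hf.1, hf.2⟩))

/-! ### Last exit from the root -/

/-- **Last-exit decomposition.**  For `y ≠ s`: `s ↔ y` in `ω` iff some open root pair `s(s,u)` (`u ≠ s`) has `u = y` or `u ↔ y` away from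
the root (in `ω` minus every pair containing `s`). [folklore] -/
theorem reach_root_iff {ω : BondConfig (Fin n)} {s y : Fin n} (hy : y ≠ s) :
    (openGraph ω).Reachable s y ↔
      ∃ u : Fin n, u ≠ s ∧ s(s, u) ∈ ω ∧ (u = y ∨ (openGraph (ω \ {f : Sym2 (Fin n) | s ∈ f})).Reachable u y) := by
  constructor
  · intro h
    have key : ∀ z : Fin n, Relation.ReflTransGen (openGraph ω).Adj s z →
        z = s ∨ ∃ u : Fin n, u ≠ s ∧ s(s, u) ∈ ω ∧ (u = z ∨ (openGraph (ω \ {f : Sym2 (Fin n) | s ∈ f})).Reachable u z) := by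
      intro z hz
      induction hz with
      | refl => exact Or.inl rfl
      | @tail b c _ hbc ih =>
        rw [openGraph_adj] at hbc
        obtain ⟨hbc, hne⟩ := hbc
        by_cases hcs : c = s
        · exact Or.inl hcs
        right
        by_cases hbs : b = s
        · subst hbs; exact ⟨c, hcs, hbc, Or.inl rfl⟩
        rcases ih with hb | ⟨u, hus, hsu, hu⟩
        · exact absurd hb hbs
        · refine ⟨u, hus, hsu, Or.inr ?_⟩
          have hmem : s(b, c) ∈ ω \ {f : Sym2 (Fin n) | s ∈ f} := by
            refine ⟨hbc, ?_⟩
            simp only [Set.mem_setOf_eq, Sym2.mem_iff, not_or]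
            exact ⟨fun h => hbs h.symm, fun h => hcs h.symm⟩
          have hadj : (openGraph (ω \ {f : Sym2 (Fin n) | s ∈ f})).Adj b c := by
            rw [openGraph_adj]; exact ⟨hmem, hne⟩
          rcases hu with hub | hub
          · subst hub; exact hadj.reachable
          · exact hub.trans hadj.reachable
    rw [SimpleGraph.reachable_iff_reflTransGen] at h
    rcases key y h with h0 | h0
    · exact absurd h0 hy
    · exact h0
  · rintro ⟨u, hus, hsu, hu⟩
    have hadj : (openGraph ω).Adj s u := by rw [openGraph_adj]; exact ⟨hsu, hus.symm⟩
    rcases hu with rfl | hr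
    · exact hadj.reachable
    · exact hadj.reachable.trans (hr.mono (openGraph_mono (fun f hf => hf.1)))

/-! ### Push-forward under `ω ↦ ω ∪ F` -/

/-- The coin of the pair `e` under `v`, mapped by `P ↦ P ∨ (e ∈ F)`, is the coin of `e` under `v` with `F` set to weight `1`. [folklore] -/
theorem map_union_coin (v : Sym2 (Fin n) → unitInterval) (F : Set (Sym2 (Fin n))) (e : Sym2 (Fin n)) :
    (Ber(True, False, v e)).map (fun P : Prop => P ∨ e ∈ F) = Ber(True, False, (if e ∈ F then 1 else v e)) := by
  rw [map_bernoulliMeasure]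
  by_cases hS : e ∈ F
  · have h1 : (True ∨ e ∈ F) = True := propext (iff_true_intro (Or.inr hS))
    have h2 : (False ∨ e ∈ F) = True := propext (iff_true_intro (Or.inr hS))
    simp only [h1, h2, if_pos hS, bernoulliMeasure_self_eq_dirac, bernoulliMeasure_one]
  · have h1 : (True ∨ e ∈ F) = True := propext (iff_true_intro (Or.inl trivial))
    have h2 : (False ∨ e ∈ F) = False := propext (iff_false_intro (by rintro (h | h); exacts [h, hS h]))
    simp only [h1, h2, if_neg hS]

/-- **Opening a set of pairs is a push-forward**: `P_{v[F ↦ 1]}(X) = P_v{ω | ω ∪ F ∈ X}`. [folklore; Grimmett 1999 §1.3] -/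
theorem real_map_union (v : Sym2 (Fin n) → unitInterval) (F : Set (Sym2 (Fin n))) (X : Set (BondConfig (Fin n))) :
    (prodBernoulli (fun e : Sym2 (Fin n) => if e ∈ F then 1 else v e)).real X =
      (prodBernoulli v).real ((fun ω : BondConfig (Fin n) => ω ∪ F) ⁻¹' X) := by
  have hmap : (prodBernoulli v).map (fun ω : BondConfig (Fin n) => (ω ∪ F : BondConfig (Fin n))) =
      prodBernoulli (fun e : Sym2 (Fin n) => if e ∈ F then 1 else v e) := by
    have h := sigmaLaw_prodBernoulli_map_coordwise v (fun e : Sym2 (Fin n) => if e ∈ F then 1 else v e)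
      (fun (e : Sym2 (Fin n)) (P : Prop) => P ∨ e ∈ F) (map_union_coin v F)
    have hfun : (fun ω : Set (Sym2 (Fin n)) => {e | (fun (e : Sym2 (Fin n)) (P : Prop) => P ∨ e ∈ F) e (e ∈ ω)}) =
        (fun ω : BondConfig (Fin n) => (ω ∪ F : BondConfig (Fin n))) := by
      funext ω; ext e; simp only [Set.mem_setOf_eq, Set.mem_union]
    rw [hfun] at h
    exact h
  have hmeas : Measurable fun ω : BondConfig (Fin n) => (ω ∪ F : BondConfig (Fin n)) := Measurable.of_discrete
  rw [measureReal_def, measureReal_def, ← hmap, Measure.map_apply hmeas MeasurableSet.of_discrete]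

/-! ### Two more insert-couplings of the doubly pinned laws -/

/-- Insert-coupling `P⁰¹(X) = P⁰⁰((insert e₂)⁻¹ X)`. [folklore] -/
theorem pin₂_real_zero_one_eq_zero_zero (w : Sym2 (Fin n) → unitInterval) (e₁ e₂ : Sym2 (Fin n)) (X : Set (BondConfig (Fin n))) :
    (pin₂ w e₁ e₂ 0 1).real X = (pin₂ w e₁ e₂ 0 0).real ((fun ω : BondConfig (Fin n) => insert e₂ ω) ⁻¹' X) := by
  have hmeas : Measurable fun ω : BondConfig (Fin n) => insert e₂ ω := by
    refine measurable_set_iff.2 fun t => ?_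
    simp only [Set.mem_insert_iff]
    exact measurable_const.or (measurable_set_mem t)
  have hmap := goodStepEI_prodBernoulli_map_insert (Function.update (Function.update w e₁ 0) e₂ 0) e₂
  rw [Function.update_idem] at hmap
  rw [pin₂, pin₂, ← hmap, measureReal_def, measureReal_def, Measure.map_apply hmeas MeasurableSet.of_discrete]

/-- Insert-coupling `P¹⁰(X) = P⁰⁰((insert e₁)⁻¹ X)`. [folklore] -/
theorem pin₂_real_one_zero_eq_zero_zero (w : Sym2 (Fin n) → unitInterval) {e₁ e₂ : Sym2 (Fin n)} (hne : e₁ ≠ e₂) (X : Set (BondConfig (Fin n))) :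
    (pin₂ w e₁ e₂ 1 0).real X = (pin₂ w e₁ e₂ 0 0).real ((fun ω : BondConfig (Fin n) => insert e₁ ω) ⁻¹' X) := by
  have hmeas : Measurable fun ω : BondConfig (Fin n) => insert e₁ ω := by
    refine measurable_set_iff.2 fun t => ?_
    simp only [Set.mem_insert_iff]
    exact measurable_const.or (measurable_set_mem t)
  have hmap := goodStepEI_prodBernoulli_map_insert (Function.update (Function.update w e₁ 0) e₂ 0) e₁
  have hw : Function.update (Function.update (Function.update w e₁ 0) e₂ 0) e₁ 1 = Function.update (Function.update w e₁ 1) e₂ 0 := by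
    rw [Function.update_comm hne.symm, Function.update_idem]
  rw [hw] at hmap
  rw [pin₂, pin₂, ← hmap, measureReal_def, measureReal_def, Measure.map_apply hmeas MeasurableSet.of_discrete]

/-! ### Reaching a target from a root whose open pairs are controlled -/

/-- If the only root pairs `s(s,u)` (`u ≠ s`) that may be open in `ω` are `s(s,i)`, `s(s,j)`, then `s ↔ i` iff `s(s,i)` is open, or `s(s,j)` is
open and `j ↔ i` away from the root. [this work] -/
theorem mem_openConn_rootPairs {ω : BondConfig (Fin n)} {s i j : Fin n} (his : i ≠ s) (hjs : j ≠ s)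
    (hclosed : ∀ u : Fin n, u ≠ s → u ≠ i → u ≠ j → s(s, u) ∉ ω) :
    ω ∈ (openConn s i : Set (BondConfig (Fin n))) ↔
      s(s, i) ∈ ω ∨ (s(s, j) ∈ ω ∧ (openGraph (ω \ {f : Sym2 (Fin n) | s ∈ f})).Reachable j i) := by
  simp only [openConn, Set.mem_setOf_eq]
  rw [reach_root_iff his]
  constructor
  · rintro ⟨u, hus, hsu, hu⟩
    by_cases hui : u = i
    · subst hui; exact Or.inl hsu
    by_cases huj : u = j
    · subst huj
      rcases hu with h | h
      · exact absurd h hui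
      · exact Or.inr ⟨hsu, h⟩
    · exact absurd hsu (hclosed u hus hui huj)
  · rintro (h | ⟨h, hr⟩)
    · exact ⟨i, his, h, Or.inl rfl⟩
    · exact ⟨j, hjs, h, Or.inr hr⟩

/-- Same root, with the pairs of `F` (all containing `s`, none equal to `s(s,i)`) opened: `s ↔ i` in `ω ∪ F` iff `s(s,i)` is open, or `s(s,j)` is
open and `j ↔ i` away from the root, or some `F`-neighbour `u` of the root has `u ↔ i` away from the root. [this work] -/
theorem union_mem_openConn_rootPairs {ω : BondConfig (Fin n)} {s i j : Fin n} (his : i ≠ s) (hjs : j ≠ s)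
    {F : Set (Sym2 (Fin n))} (hF : ∀ e ∈ F, s ∈ e) (hFi : s(s, i) ∉ F)
    (hclosed : ∀ u : Fin n, u ≠ s → u ≠ i → u ≠ j → s(s, u) ∉ ω) :
    (ω ∪ F : BondConfig (Fin n)) ∈ (openConn s i : Set (BondConfig (Fin n))) ↔
      s(s, i) ∈ ω ∨ (s(s, j) ∈ ω ∧ (openGraph (ω \ {f : Sym2 (Fin n) | s ∈ f})).Reachable j i) ∨
        (∃ u : Fin n, u ≠ s ∧ s(s, u) ∈ F ∧ (openGraph (ω \ {f : Sym2 (Fin n) | s ∈ f})).Reachable u i) := by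
  simp only [openConn, Set.mem_setOf_eq]
  rw [reach_root_iff his, sdiff_rootPairs_union hF]
  constructor
  · rintro ⟨u, hus, hsu, hu⟩
    rcases (Set.mem_union _ _ _).1 hsu with hsu | hsu
    · by_cases hui : u = i
      · subst hui; exact Or.inl hsu
      by_cases huj : u = j
      · subst huj
        rcases hu with h | h
        · exact absurd h hui
        · exact Or.inr (Or.inl ⟨hsu, h⟩)
      · exact absurd hsu (hclosed u hus hui huj)
    · have hui : u ≠ i := by rintro rfl; exact hFi hsu
      rcases hu with h | h
      · exact absurd h hui
      · exact Or.inr (Or.inr ⟨u, hus, hsu, h⟩)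
  · rintro (h | ⟨h, hr⟩ | ⟨u, hus, hsu, hr⟩)
    · exact ⟨i, his, Set.mem_union_left _ h, Or.inl rfl⟩
    · exact ⟨j, hjs, Set.mem_union_left _ h, Or.inr hr⟩
    · exact ⟨u, hus, Set.mem_union_right _ hsu, Or.inr hr⟩


/-! ### Splitting a connection at an intermediate vertex (tools for the all-or-nothing lemma at a target) -/

/-- In the configuration with all pairs at `i` removed, nothing else reaches `i`. [folklore] -/
theorem reach_offVertex_eq {ω : BondConfig (Fin n)} {i u : Fin n}
    (h : (openGraph (ω \ {f : Sym2 (Fin n) | i ∈ f})).Reachable u i) : u = i := by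
  rw [SimpleGraph.reachable_iff_reflTransGen] at h
  rcases Relation.ReflTransGen.cases_tail h with h0 | ⟨z, -, hzi⟩
  · exact h0.symm
  · rw [openGraph_adj] at hzi
    exact absurd (Sym2.mem_mk_right z i) hzi.1.2

/-- **Splitting `{s ↔ j}` at a vertex `i`:** `s ↔ j` iff `s ↔ j` avoiding `i`, or `s ↔ i` and `i ↔ j`. [folklore] -/
theorem reach_split_at (ω : BondConfig (Fin n)) (s i j : Fin n) :
    (openGraph ω).Reachable s j ↔
      (openGraph (ω \ {f : Sym2 (Fin n) | i ∈ f})).Reachable s j ∨ ((openGraph ω).Reachable s i ∧ (openGraph ω).Reachable i j) := by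
  constructor
  · intro h
    have key : ∀ z : Fin n, Relation.ReflTransGen (openGraph ω).Adj s z →
        (openGraph (ω \ {f : Sym2 (Fin n) | i ∈ f})).Reachable s z ∨ ((openGraph ω).Reachable s i ∧ (openGraph ω).Reachable i z) := by
      intro z hz
      induction hz with
      | refl => exact Or.inl (SimpleGraph.Reachable.refl _)
      | @tail b c hsb hbc ih =>
        have hreach_b : (openGraph ω).Reachable s b := (SimpleGraph.reachable_iff_reflTransGen _ _).2 hsb
        rw [openGraph_adj] at hbc
        obtain ⟨hbc, hne⟩ := hbc
        have hadjω : (openGraph ω).Adj b c := by rw [openGraph_adj]; exact ⟨hbc, hne⟩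
        by_cases hci : c = i
        · subst hci; exact Or.inr ⟨hreach_b.trans hadjω.reachable, SimpleGraph.Reachable.refl _⟩
        by_cases hbi : b = i
        · subst hbi; exact Or.inr ⟨hreach_b, hadjω.reachable⟩
        have hadjH : (openGraph (ω \ {f : Sym2 (Fin n) | i ∈ f})).Adj b c := by
          rw [openGraph_adj]
          refine ⟨⟨hbc, ?_⟩, hne⟩
          simp only [Set.mem_setOf_eq, Sym2.mem_iff, not_or]
          exact ⟨fun h => hbi h.symm, fun h => hci h.symm⟩
        rcases ih with h1 | ⟨h2, h3⟩
        · exact Or.inl (h1.trans hadjH.reachable)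
        · exact Or.inr ⟨h2, h3.trans hadjω.reachable⟩
    exact key j ((SimpleGraph.reachable_iff_reflTransGen _ _).1 h)
  · rintro (h | ⟨h1, h2⟩)
    · exact h.mono (openGraph_mono (fun _ hf => hf.1))
    · exact h1.trans h2

end IncStar

end Summit.CriticalPhenomena.PercolationContinuityZ3.Theorems
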